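/-
Copyright (c) 2026. All rights reserved.
Released under Apache 2.0 license as described in the file LICENSE.
Authors: abc-iut cell, prover seat abc-iut-w5-d172 (wave 5, gen 2).
-/
import Literature.IUT.LogVolume.UnitLogIntoMaximalIdeal
import Literature.IUT.LogVolume.PadicSubfields
import Literature.IUT.LogVolume.FundamentalIdentity
import Literature.NumberTheory.GaloisRepresentations.UniformizerResidueIndex
import HarnessLib

/-!
# Wild ramification at `p = 2`: `e = 2`, `f = 1` over `ℚ₂` ⇒ `log₂(𝒪_K^×) ⊆ 𝔪_K` again (`‖log₂ u‖ ≤ 2^{−1/2}`)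

Proof-only companion (theorems, no definitions) of `UnitLogIntoMaximalIdeal.lean` (abc-iut-w5-d172 gen 0:
`e ≤ p − 1 ⇒ log_p(𝒪_K^×) ⊆ 𝔪_K`; at `p = 2` this covers only the UNRAMIFIED case `e = 1`),
`WildCubicUnitLogUnit.lean` (`e = p = 3`, `π³ = 3`: a unit logarithm IS a unit) and `UnitLogWildQuartic.lean`
(`e = 4`, `p = 3`: never).  Here the smallest wild case at the even prime: a complete ultrametric normed
`ℚ₂`-algebra field `K` with `e(K/ℚ₂) = 2` and residue degree `f = 1` — e.g. `ℚ₂(√−1)`, `ℚ₂(√2)`, `ℚ₂(√−2)`,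
the completions at `2` of every quadratic field ramified at `2` — has `‖log₂ u‖ ≤ 2^{−1/2} < 1` for EVERY unit
`u`, although `e = 2 > p − 1 = 1`.  Classical (Neukirch, *Algebraic Number Theory*, Ch. II (5.5)): with
`f = 1` every unit is principal, `u = 1 − x`, `‖x‖ = 2^{−m/2}`, `m ≥ 1`; in `L(u) = −Σ xⁿ/n` the terms of index
`n ∉ {2, 4}` have norm `≤ 2^{−1/2}` (`2·v₂(n) + 1 ≤ n`), and the two terms of norm `≤ 1`, `x²/2 + x⁴/4 = t + t²`
with `t = x²/2`, CANCEL modulo `𝔪`: if `t` is a unit then `t ≡ 1`, so `1 + t = 2 − (1 − t)` has norm `≤ 2^{−1/2}`.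

* `norm_logSeries_le_of_dyadic` — the series estimate under the two structural hypotheses
  (H1) `‖z‖ < 1 ⇒ ‖z‖ ≤ r` (discreteness, `r² = 1/2`) and (H2) every unit is principal;
* `isPrincipal_of_residueDegree_eq_one` — `f = 1 ⇒` (H2) (the residue field has two elements);
* **`norm_unitLog_lt_one_of_absRamificationIdx_eq_two_of_residueDegree_eq_one`** — `e = 2`, `f = 1 ⇒
  ‖log₂ u‖ < 1` for every `u`; `logUnits_subset_ball_…`, `logUnits_inter_sphere_eq_empty_…`,
  `unitLog_image_logUnits_inter_sphere_eq_empty_…` (the second iterate of `log₂` on units has EMPTY domain);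
* `exists_absRamificationIdx_eq_two_residueDegree_eq_one` — the hypotheses are inhabited: `ℚ₂(√2) ⊆ ℚ̄₂`.

Nothing here is disputed mathematics; no IUT statement is asserted.
-/

noncomputable section

open Metric Set IsLocalRing

namespace Literature.IUT.LogVolume

namespace WildDyadic

open Literature.NumberTheory.GaloisRepresentations.Ultrametric

variable {K : Type*} [NontriviallyNormedField K] [NormedAlgebra ℚ_[2] K]

/-! ## Arithmetic of the indices: `2·v₂(n) + 1 ≤ n` unless `n ∈ {2, 4}`; `v₂(n) + 1 ≤ n` always -/

/-- `v₂(n) + 1 ≤ n` for `n ≠ 0` (`2^s ≥ s + 1`). [folklore] -/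
private theorem padicVal_add_one_le {n s : ℕ} (hn : n ≠ 0) (h : 2 ^ s ∣ n) : s + 1 ≤ n := by
  have hle : 2 ^ s ≤ n := Nat.le_of_dvd (Nat.pos_of_ne_zero hn) h
  have key : ∀ t : ℕ, t + 1 ≤ 2 ^ t := fun t => by
    induction t with
    | zero => norm_num
    | succ t ih => rw [pow_succ]; omega
  exact (key s).trans hle

/-- `2·v₂(n) + 1 ≤ n` for `n ∉ {0, 2, 4}` with `2^s ∣ n` (the quadratic and quartic indices are the ONLY
exceptions). [folklore] -/
private theorem two_mul_padicVal_add_one_le {n s : ℕ} (hn : n ≠ 0) (hn2 : n ≠ 2) (hn4 : n ≠ 4)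
    (h : 2 ^ s ∣ n) : 2 * s + 1 ≤ n := by
  have hle : 2 ^ s ≤ n := Nat.le_of_dvd (Nat.pos_of_ne_zero hn) h
  rcases s with _ | _ | _ | s
  · omega
  · -- `s = 1`: `n = 2t`, `t ≥ 2` since `n ≠ 2`… but `n = 4` is excluded too, so `n ≥ 6` or `n = 4`
    obtain ⟨t, rfl⟩ := h
    omega
  · -- `s = 2`: `n = 4t`, `n ≠ 4` ⇒ `t ≥ 2` ⇒ `n ≥ 8 ≥ 5`
    obtain ⟨t, rfl⟩ := h
    omega
  · have key : ∀ t : ℕ, 2 * (t + 3) + 1 ≤ 2 ^ (t + 3) := fun t => by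
      induction t with
      | zero => norm_num
      | succ t ih => rw [pow_succ]; omega
    exact (key s).trans hle

/-! ## Sizes of the terms of the logarithmic series (`p = 2`) -/

/-- Lower bound for the absolute value of a nonzero natural number: `‖m‖ ≥ 2^{−v₂(m)}`.
[cite: NeukirchANT1999, Ch. II (5.5)] -/
theorem zpow_neg_padicValNat_le_norm_natCast {m : ℕ} (hm : m ≠ 0) :
    (2 : ℝ) ^ (-(padicValNat 2 m : ℤ)) ≤ ‖(m : K)‖ := by
  rw [norm_natCast_eq_padicNorm 2 K]
  have hnd : ¬ 2 ^ (padicValNat 2 m + 1) ∣ m := pow_succ_padicValNat_not_dvd hm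
  have h1 : ¬ ‖((m : ℤ) : ℚ_[2])‖ ≤ ((2 : ℕ) : ℝ) ^ (-((padicValNat 2 m + 1 : ℕ) : ℤ)) := by
    rw [Padic.norm_int_le_pow_iff_dvd]
    exact_mod_cast hnd
  rw [Int.cast_natCast] at h1
  have h2 := not_lt.mp ((Padic.norm_le_pow_iff_norm_lt_pow_add_one (m : ℚ_[2])
    (-((padicValNat 2 m + 1 : ℕ) : ℤ))).not.mp h1)
  have h3 : -((padicValNat 2 m + 1 : ℕ) : ℤ) + 1 = -(padicValNat 2 m : ℤ) := by push_cast; ring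
  rw [h3] at h2
  exact_mod_cast h2

/-- **Size of the terms**: `‖x^{n+1}/(n+1)‖ ≤ ‖x‖^{n+1}·2^{v₂(n+1)}`. [cite: NeukirchANT1999, Ch. II (5.4)] -/
theorem norm_logTerm_le (x : K) (n : ℕ) :
    ‖-(x ^ (n + 1)) / (n + 1 : K)‖ ≤ ‖x‖ ^ (n + 1) * (2 : ℝ) ^ padicValNat 2 (n + 1) := by
  have hpos : (0 : ℝ) < (2 : ℝ) ^ (-(padicValNat 2 (n + 1) : ℤ)) := zpow_pos (by norm_num) _
  have hle := zpow_neg_padicValNat_le_norm_natCast (K := K) (m := n + 1) (by omega)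
  have hcast : ((n : K) + 1) = ((n + 1 : ℕ) : K) := by push_cast; ring
  rw [norm_div, norm_neg, norm_pow, hcast, div_le_iff₀ (hpos.trans_le hle)]
  calc ‖x‖ ^ (n + 1)
      = ‖x‖ ^ (n + 1) * (2 : ℝ) ^ padicValNat 2 (n + 1) * (2 : ℝ) ^ (-(padicValNat 2 (n + 1) : ℤ)) := by
        rw [zpow_neg, zpow_natCast, mul_assoc, mul_inv_cancel₀ (pow_ne_zero _ (by norm_num)), mul_one]
    _ ≤ ‖x‖ ^ (n + 1) * (2 : ℝ) ^ padicValNat 2 (n + 1) * ‖((n + 1 : ℕ) : K)‖ := by gcongr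

/-- If `‖x‖ ≤ r` with `r² = 1/2` then every term of index `n + 1 ∉ {2, 4}` has norm `≤ r`
(`r^{n+1}·2^{v} ≤ r^{2v+1}·2^{v} = r`). [cite: NeukirchANT1999, Ch. II (5.5)] -/
theorem norm_logTerm_le_of_norm_le {r : ℝ} (hr : 0 < r) (hr2 : r ^ 2 = 2⁻¹) {x : K} (hx : ‖x‖ ≤ r) {n : ℕ}
    (hn2 : n + 1 ≠ 2) (hn4 : n + 1 ≠ 4) : ‖-(x ^ (n + 1)) / (n + 1 : K)‖ ≤ r := by
  have hr1 : r ≤ 1 := (pow_le_one_iff_of_nonneg hr.le (by norm_num : (2 : ℕ) ≠ 0)).mp (by rw [hr2]; norm_num)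
  have hkey : ∀ v : ℕ, r ^ (2 * v + 1) * (2 : ℝ) ^ v = r := fun v => by
    rw [pow_succ, pow_mul, hr2, mul_right_comm, ← mul_pow, inv_mul_cancel₀ (by norm_num : (2 : ℝ) ≠ 0),
      one_pow, one_mul]
  refine (norm_logTerm_le x n).trans ?_
  have hv := two_mul_padicVal_add_one_le (n := n + 1) (s := padicValNat 2 (n + 1)) (by omega) hn2 hn4
    pow_padicValNat_dvd
  calc ‖x‖ ^ (n + 1) * (2 : ℝ) ^ padicValNat 2 (n + 1)
      ≤ r ^ (n + 1) * (2 : ℝ) ^ padicValNat 2 (n + 1) := by gcongr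
    _ ≤ r ^ (2 * padicValNat 2 (n + 1) + 1) * (2 : ℝ) ^ padicValNat 2 (n + 1) := by
        gcongr ?_ * _
        exact pow_le_pow_of_le_one hr.le hr1 hv
    _ = r := hkey _

/-- If `‖x‖ ≤ 1/2` then EVERY term has norm `≤ 1/2` (`(1/2)^{n+1}·2^{v} ≤ (1/2)^{v+1}·2^v = 1/2`).
[cite: NeukirchANT1999, Ch. II (5.5)] -/
theorem norm_logTerm_le_half {x : K} (hx : ‖x‖ ≤ 2⁻¹) (n : ℕ) : ‖-(x ^ (n + 1)) / (n + 1 : K)‖ ≤ 2⁻¹ := by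
  have hkey : ∀ v : ℕ, (2⁻¹ : ℝ) ^ (v + 1) * (2 : ℝ) ^ v = 2⁻¹ := fun v => by
    rw [pow_succ, mul_right_comm, ← mul_pow, inv_mul_cancel₀ (by norm_num : (2 : ℝ) ≠ 0), one_pow, one_mul]
  refine (norm_logTerm_le x n).trans ?_
  have hv := padicVal_add_one_le (n := n + 1) (s := padicValNat 2 (n + 1)) (by omega) pow_padicValNat_dvd
  calc ‖x‖ ^ (n + 1) * (2 : ℝ) ^ padicValNat 2 (n + 1)
      ≤ (2⁻¹ : ℝ) ^ (n + 1) * (2 : ℝ) ^ padicValNat 2 (n + 1) := by gcongr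
    _ ≤ (2⁻¹ : ℝ) ^ (padicValNat 2 (n + 1) + 1) * (2 : ℝ) ^ padicValNat 2 (n + 1) := by
        gcongr ?_ * _
        exact pow_le_pow_of_le_one (by norm_num) (by norm_num) hv
    _ = 2⁻¹ := hkey _

/-- `‖2‖ = 1/2` in a normed `ℚ₂`-algebra. [cite: NeukirchANT1999, Ch. II (5.5)] -/
theorem norm_two : ‖(2 : K)‖ = 2⁻¹ := by
  have h := norm_prime 2 K
  simpa using h

variable [IsUltrametricDist K]

/-- **The cancellation**: for `t` with `‖t‖ ≤ 1`, under (H1) `‖z‖ < 1 ⇒ ‖z‖ ≤ r` (`r ≥ 1/2`) and (H2) every unit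
is principal, `‖t + t²‖ ≤ r`: if `‖t‖ < 1` then `‖t + t²‖ = ‖t‖·‖1 + t‖ ≤ ‖t‖ ≤ r`; if `‖t‖ = 1` then `t ≡ 1`
and `1 + t = 2 − (1 − t)` has norm `≤ max(1/2, r) = r`. [cite: NeukirchANT1999, Ch. II (5.5)] -/
theorem norm_add_sq_le {r : ℝ} (hhalf : 2⁻¹ ≤ r) (hdisc : ∀ z : K, ‖z‖ < 1 → ‖z‖ ≤ r)
    (hprinc : ∀ u : K, ‖u‖ = 1 → IsPrincipal u) {t : K} (ht : ‖t‖ ≤ 1) : ‖t + t ^ 2‖ ≤ r := by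
  have hfac : t + t ^ 2 = t * (1 + t) := by ring
  rw [hfac, norm_mul]
  rcases ht.lt_or_eq with hlt | heq
  · have h1 : ‖1 + t‖ ≤ 1 := (IsUltrametricDist.norm_add_le_max _ _).trans (max_le (by rw [norm_one]) ht)
    calc ‖t‖ * ‖1 + t‖ ≤ ‖t‖ * 1 := by gcongr
      _ ≤ r := by rw [mul_one]; exact hdisc t hlt
  · have hp : ‖1 - t‖ < 1 := hprinc t heq
    have h2 : 1 + t = 2 + -(1 - t) := by ring
    have h1t : ‖1 + t‖ ≤ r := by
      rw [h2]
      refine (IsUltrametricDist.norm_add_le_max _ _).trans (max_le ?_ ?_)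
      · rw [norm_two]; exact hhalf
      · rw [norm_neg]; exact hdisc _ hp
    calc ‖t‖ * ‖1 + t‖ ≤ 1 * r := by gcongr
      _ = r := one_mul r

variable [CompleteSpace K]

/-- **The series estimate**: under (H1) and (H2), every principal unit `y` has `‖L(y)‖ ≤ r` (`r² = 1/2`): with
`x = 1 − y`, `L(y) = −(x + x³/3) − (x²/2 + x⁴/4) − T` where `‖T‖ ≤ r` (indices `≥ 5`), `‖x‖, ‖x³/3‖ ≤ r`, and
`x²/2 + x⁴/4 = t + t²` (`t = x²/2`, `‖t‖ ≤ 1`) has norm `≤ r` by the cancellation. [cite: NeukirchANT1999, Ch. II (5.5)] -/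
theorem norm_logSeries_le_of_dyadic {r : ℝ} (hr : 0 < r) (hr2 : r ^ 2 = 2⁻¹)
    (hdisc : ∀ z : K, ‖z‖ < 1 → ‖z‖ ≤ r) (hprinc : ∀ u : K, ‖u‖ = 1 → IsPrincipal u)
    {y : K} (hy : IsPrincipal y) : ‖logSeries y‖ ≤ r := by
  have hr1 : r < 1 := (pow_lt_one_iff_of_nonneg hr.le (by norm_num : (2 : ℕ) ≠ 0)).mp (by rw [hr2]; norm_num)
  have hhalf : (2⁻¹ : ℝ) ≤ r := by nlinarith
  set x : K := 1 - y with hxdef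
  have hx : ‖x‖ ≤ r := hdisc x hy
  set f : ℕ → K := fun n => -(x ^ (n + 1)) / (n + 1 : K) with hfdef
  have hsum : HasSum f (logSeries y) := hasSum_logSeries 2 hy
  have htail := (hasSum_nat_add_iff' 4).mpr hsum
  -- the tail (indices `≥ 5`) has norm `≤ r`
  have hT : ‖logSeries y - ∑ i ∈ Finset.range 4, f i‖ ≤ r := by
    rw [← htail.tsum_eq]
    refine IsUltrametricDist.norm_tsum_le_of_forall_le_of_nonneg hr.le fun n => ?_
    exact norm_logTerm_le_of_norm_le hr hr2 hx (by omega) (by omega)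
  have h0 : ‖f 0‖ ≤ r := norm_logTerm_le_of_norm_le hr hr2 hx (by omega) (by omega)
  have h2 : ‖f 2‖ ≤ r := norm_logTerm_le_of_norm_le hr hr2 hx (by omega) (by omega)
  -- the two exceptional terms: `f 1 + f 3 = −(t + t²)`, `t = x²/2`
  have ht1 : ‖x ^ 2 / 2‖ ≤ 1 := by
    rw [norm_div, norm_pow, norm_two, div_le_iff₀ (by norm_num : (0 : ℝ) < 2⁻¹), one_mul]
    calc ‖x‖ ^ 2 ≤ r ^ 2 := by gcongr
      _ = 2⁻¹ := hr2
  have hsq : (x ^ 2 / 2) ^ 2 = x ^ 4 / 4 := by rw [div_pow, ← pow_mul]; norm_num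
  have h13 : f 1 + f 3 = -(x ^ 2 / 2 + (x ^ 2 / 2) ^ 2) := by
    rw [hsq]
    simp only [hfdef]
    push_cast
    ring
  have h13' : ‖f 1 + f 3‖ ≤ r := by
    rw [h13, norm_neg]
    exact norm_add_sq_le hhalf hdisc hprinc ht1
  have hsplit : logSeries y = (f 0 + f 2) + (f 1 + f 3) + (logSeries y - ∑ i ∈ Finset.range 4, f i) := by
    rw [Finset.sum_range_succ, Finset.sum_range_succ, Finset.sum_range_succ, Finset.sum_range_succ,
      Finset.sum_range_zero]
    ring
  rw [hsplit]
  refine (IsUltrametricDist.norm_add_le_max _ _).trans (max_le ?_ hT)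
  refine (IsUltrametricDist.norm_add_le_max _ _).trans (max_le ?_ h13')
  exact (IsUltrametricDist.norm_add_le_max _ _).trans (max_le h0 h2)

/-! ## `f = 1`: every unit is principal -/

omit [CompleteSpace K] in
open scoped NormedField in
/-- **Residue degree one ⇒ every unit is principal**: the residue field `𝒪/𝔪` has `2^f = 2` elements, so the
residue of a unit, being nonzero, is `1`, i.e. `u ≡ 1 (mod 𝔪)`. [cite: NeukirchANT1999, Ch. II (5.3)] -/
theorem isPrincipal_of_residueDegree_eq_one [ProperSpace K] (hf : residueDegree 2 K = 1) {u : K}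
    (hu : ‖u‖ = 1) : IsPrincipal u := by
  have hcard : Nat.card (ResidueField (Valued.integer K)) = 2 := by rw [card_residueField 2 K, hf, pow_one]
  set u' : Valued.integer K := ⟨u, Valued.integer.mem_iff.mpr hu.le⟩ with hu'
  have hne : residue (Valued.integer K) u' ≠ 0 := by
    rw [Ne, residue_eq_zero_iff, mem_maximalIdeal_iff_norm_lt_one]
    show ¬ ‖u‖ < 1
    rw [hu]; exact lt_irrefl 1
  obtain ⟨a, b, hab, huniv⟩ := Nat.card_eq_two_iff.mp hcard
  have hmem : ∀ z : ResidueField (Valued.integer K), z = a ∨ z = b := fun z => by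
    have hz : z ∈ ({a, b} : Set _) := by rw [huniv]; exact Set.mem_univ z
    simpa using hz
  have h01 : (0 : ResidueField (Valued.integer K)) ≠ 1 := zero_ne_one
  have heq : residue (Valued.integer K) u' = 1 := by
    rcases hmem 0 with h0 | h0 <;> rcases hmem 1 with h1 | h1 <;>
      rcases hmem (residue (Valued.integer K) u') with hr | hr
    all_goals first
      | exact absurd (h0.trans h1.symm) h01
      | exact absurd (hr.trans h0.symm) hne
      | exact hr.trans h1.symm
  have hm : u' - 1 ∈ maximalIdeal (Valued.integer K) := by
    rw [← residue_eq_zero_iff, map_sub, map_one, heq, sub_self]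
  rw [mem_maximalIdeal_iff_norm_lt_one] at hm
  show ‖1 - u‖ < 1
  rw [norm_sub_rev]
  exact hm

/-! ## `e = 2`, `f = 1`: the logarithm of a unit lies in the maximal ideal -/

/-- `(2^{−1/2})² = 1/2`. [folklore] -/
private theorem rpow_neg_half_sq : ((2 : ℝ) ^ (-(1 / 2 : ℝ))) ^ 2 = 2⁻¹ := by
  rw [← Real.rpow_natCast, ← Real.rpow_mul (by norm_num)]
  norm_num [Real.rpow_neg_one]

variable [ProperSpace K]

/-- **`e(K/ℚ₂) = 2`, `f(K/ℚ₂) = 1` ⇒ `‖log₂ u‖ ≤ 2^{−1/2}` for every `u : K`** (principal units by `f = 1`,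
discreteness `‖z‖ < 1 ⇒ ‖z‖ ≤ 2^{−1/e}` by abc-iut-S1's `norm_le_rpow_of_norm_lt_one`, then the series estimate;
the junk value `0` for non-units). [cite: NeukirchANT1999, Ch. II (5.5)] -/
theorem norm_unitLog_le_of_absRamificationIdx_eq_two_of_residueDegree_eq_one (he : absRamificationIdx 2 K = 2)
    (hf : residueDegree 2 K = 1) (u : K) : ‖unitLog u‖ ≤ (2 : ℝ) ^ (-(1 / 2 : ℝ)) := by
  have hrpos : (0 : ℝ) < (2 : ℝ) ^ (-(1 / 2 : ℝ)) := Real.rpow_pos_of_pos (by norm_num) _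
  have hdisc : ∀ z : K, ‖z‖ < 1 → ‖z‖ ≤ (2 : ℝ) ^ (-(1 / 2 : ℝ)) := fun z hz => by
    have h := norm_le_rpow_of_norm_lt_one 2 K hz
    rw [he] at h
    push_cast at h
    exact h
  have hprinc : ∀ u : K, ‖u‖ = 1 → IsPrincipal u := fun u hu => isPrincipal_of_residueDegree_eq_one hf hu
  by_cases hu : ‖u‖ = 1
  · rw [unitLog_of_isPrincipal 2 (hprinc u hu)]
    exact norm_logSeries_le_of_dyadic hrpos rpow_neg_half_sq hdisc hprinc (hprinc u hu)
  · rw [unitLog_of_norm_ne_one hu, norm_zero]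
    exact hrpos.le

/-- **`e = 2`, `f = 1` over `ℚ₂` ⇒ `‖log₂ u‖ < 1` for every `u`**: `log₂(𝒪_K^×) ⊆ 𝔪_K` although
`e = 2 > p − 1 = 1`. [cite: NeukirchANT1999, Ch. II (5.5)] -/
theorem norm_unitLog_lt_one_of_absRamificationIdx_eq_two_of_residueDegree_eq_one (he : absRamificationIdx 2 K = 2)
    (hf : residueDegree 2 K = 1) (u : K) : ‖unitLog u‖ < 1 :=
  (norm_unitLog_le_of_absRamificationIdx_eq_two_of_residueDegree_eq_one he hf u).trans_lt
    (Real.rpow_lt_one_of_one_lt_of_neg (by norm_num) (by norm_num))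

/-- `log₂(𝒪_K^×) ⊆ 𝔪_K` (the open unit ball) for `e = 2`, `f = 1`. [cite: NeukirchANT1999, Ch. II (5.5)] -/
theorem logUnits_subset_ball_of_absRamificationIdx_eq_two_of_residueDegree_eq_one
    (he : absRamificationIdx 2 K = 2) (hf : residueDegree 2 K = 1) : logUnits K ⊆ ball 0 1 := by
  rintro _ ⟨u, -, rfl⟩
  rw [mem_ball_zero_iff]
  exact norm_unitLog_lt_one_of_absRamificationIdx_eq_two_of_residueDegree_eq_one he hf u

/-- **`log₂(𝒪_K^×)` misses the unit sphere** for `e = 2`, `f = 1` — so the second iterate of `log₂` on units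
has empty domain, exactly as in the tame range. [cite: NeukirchANT1999, Ch. II (5.5)] -/
theorem logUnits_inter_sphere_eq_empty_of_absRamificationIdx_eq_two_of_residueDegree_eq_one
    (he : absRamificationIdx 2 K = 2) (hf : residueDegree 2 K = 1) : logUnits K ∩ sphere 0 1 = ∅ := by
  ext z
  simp only [mem_inter_iff, mem_sphere_zero_iff_norm, mem_empty_iff_false, iff_false, not_and]
  rintro ⟨u, -, rfl⟩
  exact (norm_unitLog_lt_one_of_absRamificationIdx_eq_two_of_residueDegree_eq_one he hf u).ne

/-- … and the second iterate has empty image. [cite: NeukirchANT1999, Ch. II (5.5)] -/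
theorem unitLog_image_logUnits_inter_sphere_eq_empty_of_absRamificationIdx_eq_two_of_residueDegree_eq_one
    (he : absRamificationIdx 2 K = 2) (hf : residueDegree 2 K = 1) :
    unitLog '' (logUnits K ∩ sphere 0 1) = ∅ := by
  rw [logUnits_inter_sphere_eq_empty_of_absRamificationIdx_eq_two_of_residueDegree_eq_one he hf, image_empty]

/-! ## The hypotheses are inhabited: `ℚ₂(√2) ⊆ ℚ̄₂` -/

open Polynomial IntermediateField in
/-- **`E = ℚ₂(√2) ⊆ ℚ̄₂` has `e = 2` and `f = 1`**: `[E : ℚ₂] ≤ 2` (minimal polynomial divides `X² − 2`), so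
`e·f ≤ 2` (abc-iut-S1's fundamental identity); `‖√2‖ = 2^{−1/2} ≤ 2^{−1/e}` forces `e ≥ 2`; hence `e = 2`, `f = 1`.
[cite: NeukirchANT1999, Ch. II (5.5)] -/
theorem exists_absRamificationIdx_eq_two_residueDegree_eq_one :
    ∃ (E : IntermediateField ℚ_[2] (PadicAlgCl 2)) (_ : FiniteDimensional ℚ_[2] E),
      absRamificationIdx 2 E = 2 ∧ residueDegree 2 E = 1 := by
  obtain ⟨α, hα⟩ := IsAlgClosed.exists_pow_nat_eq (2 : PadicAlgCl 2) (by norm_num : 0 < 2)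
  have h2 : algebraMap ℚ_[2] (PadicAlgCl 2) 2 = 2 := map_ofNat _ 2
  have heval : Polynomial.aeval α (X ^ 2 - C (2 : ℚ_[2])) = 0 := by
    simp [hα, h2]
  have hint : IsIntegral ℚ_[2] α := ⟨X ^ 2 - C 2, monic_X_pow_sub_C 2 (by norm_num), by
    simpa [Polynomial.aeval_def] using heval⟩
  haveI hfd : FiniteDimensional ℚ_[2] ℚ_[2]⟮α⟯ := adjoin.finiteDimensional hint
  have hπ : (⟨α, mem_adjoin_simple_self ℚ_[2] α⟩ : ℚ_[2]⟮α⟯) ^ 2 = 2 := by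
    apply Subtype.ext
    have h2E : ((2 : ℚ_[2]⟮α⟯) : PadicAlgCl 2) = 2 := map_ofNat (algebraMap ℚ_[2]⟮α⟯ (PadicAlgCl 2)) 2
    simp [hα, h2E]
  refine ⟨ℚ_[2]⟮α⟯, hfd, ?_⟩
  set π : ℚ_[2]⟮α⟯ := ⟨α, mem_adjoin_simple_self ℚ_[2] α⟩ with hπdef
  have hdeg : Module.finrank ℚ_[2] ℚ_[2]⟮α⟯ ≤ 2 := by
    rw [adjoin.finrank hint]
    have hdvd : minpoly ℚ_[2] α ∣ X ^ 2 - C 2 := minpoly.dvd ℚ_[2] α heval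
    have hne : (X ^ 2 - C (2 : ℚ_[2])) ≠ 0 := (monic_X_pow_sub_C 2 (by norm_num)).ne_zero
    calc (minpoly ℚ_[2] α).natDegree ≤ (X ^ 2 - C (2 : ℚ_[2])).natDegree := natDegree_le_of_dvd hdvd hne
      _ = 2 := natDegree_X_pow_sub_C
  have hef := absRamificationIdx_mul_residueDegree 2 (ℚ_[2]⟮α⟯ : Type _)
  have hf := residueDegree_pos 2 (ℚ_[2]⟮α⟯ : Type _)
  -- `e ≥ 2`
  have hnorm2 : ‖π‖ ^ 2 = 2⁻¹ := by
    rw [← norm_pow, hπ]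
    have := norm_prime 2 (ℚ_[2]⟮α⟯ : Type _)
    simpa using this
  have hπlt : ‖π‖ < 1 :=
    (pow_lt_one_iff_of_nonneg (norm_nonneg _) (by norm_num : (2 : ℕ) ≠ 0)).mp (by rw [hnorm2]; norm_num)
  have hdisc := norm_le_rpow_of_norm_lt_one 2 (ℚ_[2]⟮α⟯ : Type _) hπlt
  set e := absRamificationIdx 2 ℚ_[2]⟮α⟯ with hedef
  have he0 : (0 : ℝ) < e := by exact_mod_cast absRamificationIdx_pos 2 (ℚ_[2]⟮α⟯ : Type _)
  have h4 : ‖π‖ ^ 2 ≤ ((2 : ℝ) ^ (-(1 / (e : ℝ)))) ^ 2 := pow_le_pow_left₀ (norm_nonneg _) hdisc 2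
  rw [hnorm2, ← Real.rpow_natCast, ← Real.rpow_mul (by norm_num), ← Real.rpow_neg_one,
    Real.rpow_le_rpow_left_iff (by norm_num : (1 : ℝ) < 2)] at h4
  have hege : (2 : ℝ) ≤ e := by
    have h := mul_le_mul_of_nonneg_right h4 he0.le
    field_simp at h
    push_cast at h
    nlinarith
  have hege' : 2 ≤ e := by exact_mod_cast hege
  -- `e·f ≤ 2` with `f ≥ 1` ⇒ `e = 2`, `f = 1`
  have hprod : e * residueDegree 2 ℚ_[2]⟮α⟯ ≤ 2 := hef.trans_le hdeg
  constructor
  · nlinarith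
  · nlinarith

end WildDyadic

end Literature.IUT.LogVolume

end
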